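import Mathlib.RingTheory.TensorProduct.Basic
import Literature.AlgebraicGeometry.Motives.AbelianVarietyCotangentChart
import Literature.AlgebraicGeometry.Morphisms.FibreChartRing
import HarnessLib

/-!
# The cotangent space at the origin of a fibre of a model: `T_e^*(X ×_R κ) ≅ κ ⊗_R I/I²`

Topic `Literature/AlgebraicGeometry/Motives`, namespace `Literature.AlgebraicGeometry.Motives.AbelianVariety`.  DEFINITIONS
(linear maps / a linear equivalence, a restriction-of-scalars structure) and THEOREMS; no named fact (net debt 0).
Brick G3b-2 of cell `hodgecm-mathlib`, row II-2β (`shimura1998_prop26_definedOverQbar`): the last CM-free piece of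
the specialisation argument for the TYPE of a CM abelian scheme — the cotangent space at the origin of a FIBRE of a model
over a ring `R`, as the base change of the conormal module of the unit section.

THE PRINT.  Görtz–Wedhorn, *Algebraic Geometry II*, (17.3)–Remark 17.15: for the section `e : Spec R → X` of
`f : X → Spec R` with affine chart `W = Spec Γ(X, W) ⊇ e(Spec R)` and ideal `I = ker e^♯`, the conormal module is
`𝒞_e = I/I²`; for the CARTESIAN square given by a point `Spec κ → Spec R` (fibre `A = X ×_R κ`, section `e_A`), the
comparison `w : 𝒞_e ⊗ κ → 𝒞_{e_A}` is surjective (Remark 17.15 (1)), and `𝒞_{e_A} = 𝔪_{e_A}/𝔪_{e_A}² = T_{e_A}^*(A)`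
for the `κ`-rational point `e_A` ((17.3) with Görtz–Wedhorn I (6.3.1)).  Here, for `A` an abelian variety over the
field `κ` (so that the tree's `AbelianVariety.Cotangent A` is available), the comparison is an ISOMORPHISM
`κ ⊗_R I/I² ≅ T_e^*(A)`, assembled from `Morphisms/FibreChartRing.fibreChartIso` (`Γ(A, p⁻¹W) = κ ⊗_R Γ(X, W)`),
`RingTheory/Smooth/AugmentationIdealCotangentBaseChange.tensorCotangentEquivOfAugmentation` (`κ ⊗_R I/I² = I_κ/I_κ²`)
and `Motives/AbelianVarietyCotangentChart.cotangentChartEquiv` (`𝔪_U/𝔪_U² = 𝔪_e/𝔪_e²`).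

INPUT (no `Over.pullback` in the hypotheses): `f : X ⟶ Spec R`, a section `e`, an affine `W` with `e⁻¹W = ⊤`,
`[Algebra R κ]`, `A : AbelianVariety κ`, `p : A.X.left ⟶ X`, `hP : IsPullback p A.X.hom f (Spec.map (R → κ))`,
`horig : unitPt A ≫ p = Spec.map (R → κ) ≫ e`; `hU`, `heU` are ANY proofs that `U = p⁻¹W` is affine and contains the origin.
WHAT IS HERE: `app_mem_chartIdeal` (`p^♯(I) ⊆ 𝔪_U`), `app_val_algebraMap` (`p^♯ f^♯ = t^♯`), `conormalToCotangent :
I/I² →ₗ[R] T_e^*(A)`, `cotangentFibreMap : κ ⊗[R] I/I² →ₗ[κ] T_e^*(A)` (`_tmul`, `_eq_comp`, `_bijective`),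
`map_fibreChartIso_augIdealBaseChange` (`Θ(I_κ) = 𝔪_U`), **`cotangentFibreEquiv : κ ⊗[R] I/I² ≃ₗ[κ] Cotangent A`**.
Sequel: `Motives/AbelianVarietyCotangentOfFibreEndo` (equivariance, characteristic polynomials).

## References
* [GortzWedhorn2023] U. Görtz, T. Wedhorn, *Algebraic Geometry II* (2023), (17.3) (17.3.1), Remark 17.14, Remark 17.15 (1).
* [GortzWedhorn2020] U. Görtz, T. Wedhorn, *Algebraic Geometry I*, 2nd ed. (2020), §6.3 (6.3.1), Remark 6.12 (2)–(3), Prop. 4.20.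
-/

noncomputable section

set_option backward.isDefEq.respectTransparency false -- `TopCat.Presheaf` is not reducible

open CategoryTheory CategoryTheory.Limits AlgebraicGeometry TopologicalSpace Opposite TensorProduct
open Literature.RingTheory.Smooth

universe u

namespace Literature.AlgebraicGeometry.Motives

namespace AbelianVariety

open Literature.AlgebraicGeometry.Morphisms Literature.AlgebraicGeometry.Morphisms.ChartRing

variable {R κ : Type u} [CommRing R] [Field κ] [Algebra R κ] {X : Scheme.{u}} (f : X ⟶ Spec (.of R))
  (e : Spec (.of R) ⟶ X) (he : e ≫ f = 𝟙 _) {W : X.Opens} (hW : IsAffineOpen W) (heW : e ⁻¹ᵁ W = ⊤)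
  (A : AbelianVariety κ) (p : A.X.left ⟶ X)
  (hP : IsPullback p A.X.hom f (Spec.map (CommRingCat.ofHom (algebraMap R κ))))
  (horig : unitPt A ≫ p = Spec.map (CommRingCat.ofHom (algebraMap R κ)) ≫ e)

/-! ### Applied forms of Mathlib's `appLE` composition lemmas -/

section AppLE

variable {X' Y Z : Scheme.{u}}

/-- `f^♯_{V ≤ W} (g^♯_{U ≤ V} x) = (f ≫ g)^♯_{U ≤ W} x` (Mathlib `Scheme.Hom.appLE_comp_appLE`, applied). [folklore] -/
private theorem appLE_appLE_apply (f : X' ⟶ Y) (g : Y ⟶ Z) (U : Z.Opens) (V : Y.Opens) (W : X'.Opens)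
    (e₁ : V ≤ g ⁻¹ᵁ U) (e₂ : W ≤ f ⁻¹ᵁ V) (x : Γ(Z, U)) :
    f.appLE V W e₂ (g.appLE U V e₁ x) = (f ≫ g).appLE U W (e₂.trans ((Opens.map f.base).map (homOfLE e₁)).le) x := by
  have := congrArg (fun φ => φ.hom x) (Scheme.Hom.appLE_comp_appLE f g U V W e₁ e₂)
  simpa only [CommRingCat.hom_comp, RingHom.comp_apply] using this

/-- `appLE` along equal morphisms. [folklore] -/
private theorem appLE_congr_hom {g g' : Y ⟶ Z} (hg : g = g') (U : Z.Opens) (V : Y.Opens)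
    (hUV : V ≤ g ⁻¹ᵁ U) : g.appLE U V hUV = g'.appLE U V (hg ▸ hUV) := by
  subst hg; rfl

/-- `appTop = appLE ⊤ ⊤`, applied. [folklore] -/
private theorem appLE_top_top_apply (g : Y ⟶ Z) (x : Γ(Z, ⊤)) :
    g.appLE ⊤ ⊤ (le_top : (⊤ : Y.Opens) ≤ g ⁻¹ᵁ ⊤) x = g.appTop x := by
  change g.appLE ⊤ (g ⁻¹ᵁ ⊤) le_rfl x = g.appTop x
  rw [Scheme.Hom.appLE_eq_app]
  rfl

end AppLE

/-! ## §1 The origin of the fibre lies in the chart `p⁻¹W` -/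

include horig in
/-- **`p(e_A) = e(t_κ)`**: the origin of the fibre maps to the point of the section under the `κ`-point
`t_κ : Spec κ → Spec R`. [cite: GortzWedhorn2023, Remark 17.14 (the square of the two sections)] -/
theorem fibre_origin_eq :
    p.base (origin A) = e.base ((Spec.map (CommRingCat.ofHom (algebraMap R κ))).base (specPt κ)) := by
  change (unitPt A ≫ p).base (specPt κ) = (Spec.map (CommRingCat.ofHom (algebraMap R κ)) ≫ e).base (specPt κ)
  rw [horig]

include horig in
/-- The origin of the fibre lies in `p⁻¹ O` for every open `O ⊇ e(Spec R)`. [cite: GortzWedhorn2023, Remark 17.14] -/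
theorem origin_mem_preimage (O : X.Opens) (heO : e ⁻¹ᵁ O = ⊤) : origin A ∈ p ⁻¹ᵁ O := by
  change p.base (origin A) ∈ O
  rw [fibre_origin_eq e A p horig]
  change (Spec.map (CommRingCat.ofHom (algebraMap R κ))).base (specPt κ) ∈ e ⁻¹ᵁ O
  rw [heO]; trivial

/-! ## §2 Functions vanishing on the section vanish at the origin of the fibre -/

include hW horig in
/-- **`p^♯` maps the augmentation ideal `I = ker e^♯ ⊆ Γ(X, W)` into the ideal `𝔪_U` of the origin in
`Γ(A, U)`, `U = p⁻¹W`**: a function vanishing on the section vanishes at `p(e_A) = e(t_κ)`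
(Mathlib `IsAffineOpen.comap_primeIdealOf_appLE`, twice). [cite: GortzWedhorn2023, Remark 17.14 and Remark 17.15 (1)] -/
theorem app_mem_chartIdeal (hU : IsAffineOpen (p ⁻¹ᵁ W)) (heU : origin A ∈ p ⁻¹ᵁ W) (s : ChartRing f W)
    (hs : s ∈ augIdeal (sectionAug f e he heW)) : p.app W (val s) ∈ chartIdeal A hU heU := by
  have h0 : e.appLE W ⊤ heW.ge (val s) = 0 := (sectionAug_eq_zero_iff f e he heW s).1 ((mem_augIdeal_iff _ s).1 hs)
  -- Step 1: `s ∈ 𝔭_{e(t_κ)} ⊆ Γ(X, W)`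
  set y := (Spec.map (CommRingCat.ofHom (algebraMap R κ))).base (specPt κ) with hy
  have hyW : e.base y ∈ W := by change y ∈ e ⁻¹ᵁ W; rw [heW]; trivial
  have h1 : val s ∈ (hW.primeIdealOf ⟨e.base y, hyW⟩).asIdeal := by
    have hc := IsAffineOpen.comap_primeIdealOf_appLE (f := e) (x := y) W hW ⊤ (isAffineOpen_top _) heW.ge trivial
    rw [← hc, PrimeSpectrum.comap_asIdeal, Ideal.mem_comap, h0]
    exact Ideal.zero_mem _
  -- Step 2: `p(e_A) = e(y)`, and `p^♯ s ∈ 𝔪_U ↔ s ∈ 𝔭_{p(e_A)}`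
  have h2 : (⟨p.base (origin A), heU⟩ : W) = ⟨e.base y, hyW⟩ := Subtype.ext (fibre_origin_eq e A p horig)
  have hc' := IsAffineOpen.comap_primeIdealOf_appLE (f := p) (x := origin A) W hW (p ⁻¹ᵁ W) hU le_rfl heU
  have : val s ∈ ((hU.primeIdealOf ⟨origin A, heU⟩).comap (p.appLE W (p ⁻¹ᵁ W) le_rfl).hom).asIdeal := by
    rw [hc', h2]; exact h1
  rw [PrimeSpectrum.comap_asIdeal, Ideal.mem_comap, Scheme.Hom.appLE_eq_app] at this
  exact this

/-! ## §3 The scalars: `p^♯ ∘ f^♯ = t^♯ ∘ (R → κ)` -/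

include hP in
/-- **`p^♯(f^♯ r) = t_A^♯(r)`** on the chart `U = p⁻¹W` (the pullback square commutes: `p ≫ f = t_A ≫ Spec(R → κ)`),
where `t_A : A → Spec κ` is the structure morphism; in the notation of `fibreConst`. [cite: GortzWedhorn2020, Prop. 4.20] -/
theorem app_val_algebraMap (r : R) :
    p.app W (val (algebraMap R (ChartRing f W) r)) = fibreConst p A.X.hom W (algebraMap R κ r) := by
  have h1 : (Scheme.ΓSpecIso (.of κ)).inv (algebraMap R κ r) =
      (Spec.map (CommRingCat.ofHom (algebraMap R κ))).appTop ((Scheme.ΓSpecIso (.of R)).inv r) := by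
    have := congrArg (fun φ => φ.hom r) (Scheme.ΓSpecIso_inv_naturality (CommRingCat.ofHom (algebraMap R κ)))
    simpa only [CommRingCat.hom_comp, RingHom.comp_apply, CommRingCat.hom_ofHom] using this
  rw [val_algebraMap, fibreConst_apply, ← Scheme.Hom.appLE_eq_app, appLE_appLE_apply, appLE_congr_hom hP.w, h1,
    ← appLE_top_top_apply, appLE_appLE_apply]

/-- The germ at the origin of the constant `c ∈ κ` restricted to a chart is `stalkOriginAlgebraMap c`. [folklore] -/
private theorem germ_fibreConst {U : A.X.left.Opens} (heU : origin A ∈ U) (c : κ) :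
    A.X.left.presheaf.germ U (origin A) heU (A.X.hom.appLE ⊤ U le_top ((Scheme.ΓSpecIso (.of κ)).inv c)) =
      stalkOriginAlgebraMap A c := by
  rw [stalkOriginAlgebraMap_apply, Scheme.Hom.appLE, CommRingCat.comp_apply]
  exact TopCat.Presheaf.germ_res_apply A.X.left.presheaf (homOfLE le_top) (origin A) heU _

/-! ## §4 The conormal module of the section maps to the cotangent space of the fibre -/

section Map

variable (hU : IsAffineOpen (p ⁻¹ᵁ W)) (heU : origin A ∈ p ⁻¹ᵁ W)

/-- `T_e^*(A)` as an `R`-module through `R → κ` (restriction of scalars). [folklore] -/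
abbrev cotangentRestrictScalars (A : AbelianVariety κ) : Module R (Cotangent A) :=
  Module.compHom (Cotangent A) (algebraMap R κ)

/-- `R → κ → T_e^*(A)` is a scalar tower. [cite: GortzWedhorn2020, Remark 6.12 (2)] -/
theorem isScalarTower_cotangentRestrictScalars (A : AbelianVariety κ) :
    letI := cotangentRestrictScalars (R := R) A
    IsScalarTower R κ (Cotangent A) :=
  letI := cotangentRestrictScalars (R := R) A
  ⟨fun r c x => by
    change (r • c) • x = algebraMap R κ r • (c • x)
    rw [Algebra.smul_def, mul_smul]⟩

include hW horig in
/-- `p^♯` maps `I` into `𝔪_U` (comap form, for `Ideal.mapCotangent`). [cite: GortzWedhorn2023, Remark 17.14] -/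
theorem augIdeal_le_comap_app :
    augIdeal (sectionAug f e he heW) ≤
      (chartIdeal A hU heU).comap (((p.app W).hom.comp (val : ChartRing f W →+* Γ(X, W))).toIntAlgHom) :=
  fun s hs => app_mem_chartIdeal f e he hW heW A p horig hU heU s hs

include hW horig in
/-- **The class map `I/I² → 𝔪_U/𝔪_U²`, `[s] ↦ [p^♯ s]`** (additive; Mathlib `Ideal.mapCotangent` along `p^♯`).
[cite: GortzWedhorn2023, Remark 17.14 (the map `w` of conormal sheaves)] -/
def conormalToChart : (augIdeal (sectionAug f e he heW)).Cotangent →ₗ[ℤ] (chartIdeal A hU heU).Cotangent :=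
  (augIdeal (sectionAug f e he heW)).mapCotangent (chartIdeal A hU heU)
    (((p.app W).hom.comp (val : ChartRing f W →+* Γ(X, W))).toIntAlgHom)
    (augIdeal_le_comap_app f e he hW heW A p horig hU heU)

/-- On classes: `conormalToChart [s] = [p^♯ s]`. [cite: GortzWedhorn2023, Remark 17.14] -/
theorem conormalToChart_toCotangent (s : augIdeal (sectionAug f e he heW)) :
    conormalToChart f e he hW heW A p horig hU heU ((augIdeal _).toCotangent s) =
      (chartIdeal A hU heU).toCotangent ⟨p.app W (val (s : ChartRing f W)),
        app_mem_chartIdeal f e he hW heW A p horig hU heU s s.2⟩ :=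
  rfl

include hW hP horig in
/-- **The conormal module of the section maps `R`-linearly to the cotangent space of the fibre at the origin**:
`I/I² → 𝔪_U/𝔪_U² ≅ 𝔪_e/𝔪_e² = T_e^*(A)`, `[s] ↦ [germ of p^♯ s]`, where `T_e^*(A)` is an `R`-module through `R → κ`
(Görtz–Wedhorn II, Remark 17.14: `w : g^* 𝒞_e → 𝒞_{e_A}`, followed by (17.3)/(6.3.1) `𝒞_{e_A} = 𝔪_e/𝔪_e²` for the
`κ`-point `e_A`). [cite: GortzWedhorn2023, Remark 17.14 and Remark 17.15 (1)] -/
def conormalToCotangent :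
    letI := cotangentRestrictScalars (R := R) A
    (augIdeal (sectionAug f e he heW)).Cotangent →ₗ[R] Cotangent A :=
  letI := cotangentRestrictScalars (R := R) A
  letI := TopCat.Presheaf.algebra_section_stalk A.X.left.presheaf ⟨origin A, heU⟩
  { toFun := fun m => cotangentChartEquiv A hU heU (conormalToChart f e he hW heW A p horig hU heU m)
    map_add' := fun m m' => by simp only [map_add]
    map_smul' := fun r m => by
      obtain ⟨x, rfl⟩ := Ideal.toCotangent_surjective _ m
      rw [RingHom.id_apply, ← LinearMap.map_smul_of_tower, conormalToChart_toCotangent, conormalToChart_toCotangent]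
      letI : Module κ (IsLocalRing.maximalIdeal (stalkOrigin A)).Cotangent := Cotangent.instModule (A := A)
      change _ = algebraMap R κ r • cotangentChartEquiv A hU heU ((chartIdeal A hU heU).toCotangent _)
      rw [← cotangentChartEquiv_toCotangent_const_mul]
      congr 2
      apply Subtype.ext
      change p.app W (val ((r • x : augIdeal (sectionAug f e he heW)) : ChartRing f W)) = _
      rw [Submodule.coe_smul_of_tower, Algebra.smul_def, map_mul, map_mul, app_val_algebraMap f A p hP,
        fibreConst_apply] }

/-- On classes: `conormalToCotangent [s] = cotangentChartEquiv [p^♯ s]`. [cite: GortzWedhorn2023, Remark 17.14] -/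
theorem conormalToCotangent_toCotangent (s : augIdeal (sectionAug f e he heW)) :
    letI := cotangentRestrictScalars (R := R) A
    letI := TopCat.Presheaf.algebra_section_stalk A.X.left.presheaf ⟨origin A, heU⟩
    conormalToCotangent f e he hW heW A p hP horig hU heU ((augIdeal _).toCotangent s) =
      cotangentChartEquiv A hU heU ((chartIdeal A hU heU).toCotangent ⟨p.app W (val (s : ChartRing f W)),
        app_mem_chartIdeal f e he hW heW A p horig hU heU s s.2⟩) :=
  rfl

/-! ## §5 `κ ⊗_R I/I² ≃ T_e^*(A)` -/

include hW hP horig in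
/-- **The comparison map `κ ⊗_R I/I² → T_e^*(A)`**, `c ⊗ [s] ↦ c · [germ of p^♯ s]` (the base change to `κ` of
`conormalToCotangent`; Görtz–Wedhorn II, Remark 17.15 (1): `g^* 𝒞_e → 𝒞_{e'}` for the cartesian square).
[cite: GortzWedhorn2023, Remark 17.15 (1)] -/
def cotangentFibreMap : κ ⊗[R] (augIdeal (sectionAug f e he heW)).Cotangent →ₗ[κ] Cotangent A :=
  letI := cotangentRestrictScalars (R := R) A
  haveI := isScalarTower_cotangentRestrictScalars (R := R) A
  (conormalToCotangent f e he hW heW A p hP horig hU heU).liftBaseChange κ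

/-- On pure tensors: `cotangentFibreMap (c ⊗ [s]) = c • cotangentChartEquiv [p^♯ s]`. [cite: GortzWedhorn2023, Remark 17.15 (1)] -/
theorem cotangentFibreMap_tmul (c : κ) (s : augIdeal (sectionAug f e he heW)) :
    letI := TopCat.Presheaf.algebra_section_stalk A.X.left.presheaf ⟨origin A, heU⟩
    letI : Module κ (IsLocalRing.maximalIdeal (stalkOrigin A)).Cotangent := Cotangent.instModule (A := A)
    cotangentFibreMap f e he hW heW A p hP horig hU heU (c ⊗ₜ[R] (augIdeal _).toCotangent s) =
      c • cotangentChartEquiv A hU heU ((chartIdeal A hU heU).toCotangent ⟨p.app W (val (s : ChartRing f W)),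
        app_mem_chartIdeal f e he hW heW A p horig hU heU s s.2⟩) := by
  letI := cotangentRestrictScalars (R := R) A
  haveI := isScalarTower_cotangentRestrictScalars (R := R) A
  change (conormalToCotangent f e he hW heW A p hP horig hU heU).liftBaseChange κ _ = _
  rw [LinearMap.liftBaseChange_tmul, conormalToCotangent_toCotangent]

end Map

/-! ## §6 The comparison map is bijective: `κ ⊗_R I/I² ≃ T_e^*(A)` -/

section Equiv

variable (hU : IsAffineOpen (p ⁻¹ᵁ W)) (heU : origin A ∈ p ⁻¹ᵁ W)

/-- A ring isomorphism `Θ` with `Θ(I) = J` induces a bijection `I/I² → J/J²`. [folklore] -/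
private theorem mapCotangent_bijective_of_map_eq {A' B : Type*} [CommRing A'] [CommRing B] (Θ : A' ≃+* B)
    (I : Ideal A') (J : Ideal B) (hJ : I.map (Θ : A' →+* B) = J) (h : I ≤ J.comap (Θ : A' →+* B).toIntAlgHom) :
    Function.Bijective (I.mapCotangent J (Θ : A' →+* B).toIntAlgHom h) := by
  have hJ' : J = I.comap Θ.symm := by rw [← hJ, Ideal.map_comap_of_equiv]
  constructor
  · rw [injective_iff_map_eq_zero]
    intro y hy
    obtain ⟨x, rfl⟩ := Ideal.toCotangent_surjective _ y
    rw [Ideal.mapCotangent_toCotangent, Ideal.toCotangent_eq_zero] at hy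
    rw [Ideal.toCotangent_eq_zero]
    have hsq : J ^ 2 = (I ^ 2).comap Θ.symm := by
      rw [← hJ, ← Ideal.map_pow, Ideal.map_comap_of_equiv]
    rw [hsq, Ideal.mem_comap] at hy
    change Θ.symm (Θ (x : A')) ∈ I ^ 2 at hy
    rwa [RingEquiv.symm_apply_apply] at hy
  · intro y
    obtain ⟨⟨b, hb⟩, rfl⟩ := Ideal.toCotangent_surjective _ y
    have hb' : Θ.symm b ∈ I := by rw [hJ', Ideal.mem_comap] at hb; exact hb
    refine ⟨I.toCotangent ⟨Θ.symm b, hb'⟩, ?_⟩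
    rw [Ideal.mapCotangent_toCotangent]
    congr 1
    apply Subtype.ext
    exact Θ.apply_symm_apply b

include he horig in
/-- **`Θ(I_κ) = 𝔪_U`**: the fibre chart isomorphism `Θ : κ ⊗_R Γ(X, W) ≅ Γ(A, U)` carries the extended augmentation ideal
`I_κ = I · (κ ⊗_R Γ(X, W))` ONTO the ideal of the origin (`I_κ = ker ε_κ` is maximal, `κ` being a field, and
`Θ(I_κ) ⊆ 𝔪_U`). [cite: GortzWedhorn2023, Remark 17.15 (1)] -/
theorem map_fibreChartIso_augIdealBaseChange :
    (augIdealBaseChange (sectionAug f e he heW) κ).map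
        (fibreChartIso f p A.X.hom hP hW : κ ⊗[R] ChartRing f W →+* Γ(A.X.left, p ⁻¹ᵁ W)) =
      chartIdeal A hU heU := by
  -- `Θ (I_κ) ≤ 𝔪_U`
  have hle : (augIdealBaseChange (sectionAug f e he heW) κ).map
      (fibreChartIso f p A.X.hom hP hW : κ ⊗[R] ChartRing f W →+* _) ≤ chartIdeal A hU heU := by
    rw [augIdealBaseChange, Ideal.map_map, Ideal.map_le_iff_le_comap]
    intro s hs
    rw [Ideal.mem_comap]
    change fibreChartIso f p A.X.hom hP hW ((1 : κ) ⊗ₜ[R] s) ∈ chartIdeal A hU heU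
    rw [fibreChartIso_one_tmul]
    exact app_mem_chartIdeal f e he hW heW A p horig hU heU s hs
  -- `I_κ` is maximal
  have hmax : (augIdealBaseChange (sectionAug f e he heW) κ).IsMaximal := by
    rw [← ker_baseChangeAugmentation]
    exact RingHom.ker_isMaximal_of_surjective _ fun c =>
      ⟨algebraMap κ _ c, (baseChangeAugmentation (sectionAug f e he heW) κ).commutes c⟩
  exact (hmax.map_bijective _ (fibreChartIso f p A.X.hom hP hW).bijective).eq_of_le
    (chartIdeal_isMaximal A hU heU).ne_top hle

include he horig in
/-- `I_κ ≤ Θ⁻¹ 𝔪_U` (comap form of the previous statement). [cite: GortzWedhorn2023, Remark 17.15 (1)] -/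
theorem augIdealBaseChange_le_comap_fibreChartIso :
    augIdealBaseChange (sectionAug f e he heW) κ ≤ (chartIdeal A hU heU).comap
      ((fibreChartIso f p A.X.hom hP hW : κ ⊗[R] ChartRing f W →+* Γ(A.X.left, p ⁻¹ᵁ W)).toIntAlgHom) := by
  rw [← map_fibreChartIso_augIdealBaseChange f e he hW heW A p hP horig hU heU]
  exact Ideal.le_comap_map

include he horig in
/-- **The class map `I_κ/I_κ² → 𝔪_U/𝔪_U²` along `Θ` is bijective.** [cite: GortzWedhorn2023, Remark 17.15 (1)] -/
theorem mapCotangent_fibreChartIso_bijective :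
    Function.Bijective ((augIdealBaseChange (sectionAug f e he heW) κ).mapCotangent (chartIdeal A hU heU)
      ((fibreChartIso f p A.X.hom hP hW : κ ⊗[R] ChartRing f W →+* Γ(A.X.left, p ⁻¹ᵁ W)).toIntAlgHom)
      (augIdealBaseChange_le_comap_fibreChartIso f e he hW heW A p hP horig hU heU)) :=
  mapCotangent_bijective_of_map_eq _ _ _ (map_fibreChartIso_augIdealBaseChange f e he hW heW A p hP horig hU heU) _

/-- `c ⊗ x ∈ I_κ` for `x ∈ I`. [folklore] -/
private theorem tmul_mem_augIdealBaseChange (c : κ) (x : augIdeal (sectionAug f e he heW)) :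
    c ⊗ₜ[R] (x : ChartRing f W) ∈ augIdealBaseChange (sectionAug f e he heW) κ := by
  have := Ideal.mul_mem_left _ (c ⊗ₜ[R] (1 : ChartRing f W)) (one_tmul_mem_augIdealBaseChange _ κ x)
  rwa [Algebra.TensorProduct.tmul_mul_tmul, mul_one, one_mul] at this

/-- `c • [1 ⊗ x] = [c ⊗ x]` in `I_κ/I_κ²`. [folklore] -/
private theorem smul_toCotangent_one_tmul (c : κ) (x : augIdeal (sectionAug f e he heW)) :
    c • (augIdealBaseChange (sectionAug f e he heW) κ).toCotangent
        ⟨(1 : κ) ⊗ₜ[R] (x : ChartRing f W), one_tmul_mem_augIdealBaseChange _ κ x⟩ =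
      (augIdealBaseChange (sectionAug f e he heW) κ).toCotangent ⟨c ⊗ₜ[R] (x : ChartRing f W),
        tmul_mem_augIdealBaseChange f e he heW c x⟩ := by
  rw [← LinearMap.map_smul_of_tower]
  congr 1
  apply Subtype.ext
  rw [Submodule.coe_smul_of_tower, Algebra.smul_def, Algebra.TensorProduct.algebraMap_apply, Algebra.algebraMap_self,
    RingHom.id_apply]
  change c ⊗ₜ[R] (1 : ChartRing f W) * ((1 : κ) ⊗ₜ[R] (x : ChartRing f W)) = c ⊗ₜ[R] (x : ChartRing f W)
  rw [Algebra.TensorProduct.tmul_mul_tmul, mul_one, one_mul]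

include he horig in
/-- **Factorisation of the comparison map**: `cotangentFibreMap = cotangentChartEquiv ∘ (Θ on classes) ∘
(κ ⊗_R I/I² ≅ I_κ/I_κ²)` — the chart isomorphism of `Motives/AbelianVarietyCotangentChart`, the fibre chart `Θ` of
`Morphisms/FibreChartRing`, and the base change of the conormal module of `RingTheory/Smooth/AugmentationIdealCotangentBaseChange`.
[cite: GortzWedhorn2023, Remark 17.15 (1)] -/
theorem cotangentFibreMap_eq_comp (z : κ ⊗[R] (augIdeal (sectionAug f e he heW)).Cotangent) :
    letI := TopCat.Presheaf.algebra_section_stalk A.X.left.presheaf ⟨origin A, heU⟩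
    cotangentFibreMap f e he hW heW A p hP horig hU heU z =
      cotangentChartEquiv A hU heU
        ((augIdealBaseChange (sectionAug f e he heW) κ).mapCotangent (chartIdeal A hU heU)
          ((fibreChartIso f p A.X.hom hP hW : κ ⊗[R] ChartRing f W →+* Γ(A.X.left, p ⁻¹ᵁ W)).toIntAlgHom)
          (augIdealBaseChange_le_comap_fibreChartIso f e he hW heW A p hP horig hU heU)
          (tensorCotangentEquivOfAugmentation (sectionAug f e he heW) κ z)) := by
  letI : Module κ (IsLocalRing.maximalIdeal (stalkOrigin A)).Cotangent := Cotangent.instModule (A := A)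
  induction z using TensorProduct.induction_on with
  | zero => simp only [map_zero]
  | add x y hx hy => simp only [map_add, hx, hy]
  | tmul c m =>
    obtain ⟨x, rfl⟩ := Ideal.toCotangent_surjective _ m
    rw [cotangentFibreMap_tmul, tensorCotangentEquivOfAugmentation_tmul, smul_toCotangent_one_tmul,
      Ideal.mapCotangent_toCotangent, ← cotangentChartEquiv_toCotangent_const_mul]
    refine congrArg (fun w => cotangentChartEquiv A hU heU ((chartIdeal A hU heU).toCotangent w)) (Subtype.ext ?_)
    change _ = fibreChartIso f p A.X.hom hP hW (c ⊗ₜ[R] (x : ChartRing f W))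
    rw [fibreChartIso_tmul, fibreConst_apply]

include he horig in
/-- **The comparison map `κ ⊗_R I/I² → T_e^*(A)` is bijective.** [cite: GortzWedhorn2023, Remark 17.15 (1)] -/
theorem cotangentFibreMap_bijective : Function.Bijective (cotangentFibreMap f e he hW heW A p hP horig hU heU) := by
  letI := TopCat.Presheaf.algebra_section_stalk A.X.left.presheaf ⟨origin A, heU⟩
  have : (cotangentFibreMap f e he hW heW A p hP horig hU heU : _ → Cotangent A) =
      (cotangentChartEquiv A hU heU) ∘
        ((augIdealBaseChange (sectionAug f e he heW) κ).mapCotangent (chartIdeal A hU heU)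
          ((fibreChartIso f p A.X.hom hP hW : κ ⊗[R] ChartRing f W →+* Γ(A.X.left, p ⁻¹ᵁ W)).toIntAlgHom)
          (augIdealBaseChange_le_comap_fibreChartIso f e he hW heW A p hP horig hU heU)) ∘
        (tensorCotangentEquivOfAugmentation (sectionAug f e he heW) κ) :=
    funext fun z => cotangentFibreMap_eq_comp f e he hW heW A p hP horig hU heU z
  rw [this]
  exact ((cotangentChartEquiv A hU heU).bijective.comp
    (mapCotangent_fibreChartIso_bijective f e he hW heW A p hP horig hU heU)).comp
    (tensorCotangentEquivOfAugmentation (sectionAug f e he heW) κ).bijective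

include he horig in
/-- **`κ ⊗_R I/I² ≃ T_e^*(A)`**: the cotangent space at the origin of the fibre `A = X ×_R κ` of an `R`-scheme with a
section landing in an affine chart `W` IS the base change of the conormal module `I/I²` of the section on that chart
(Görtz–Wedhorn II, Remark 17.15 (1) with (17.3)/(6.3.1); no flatness or smoothness hypothesis).
[cite: GortzWedhorn2023, Remark 17.15 (1)] [cite: GortzWedhorn2020, Remark 6.12 (2)–(3)] -/
def cotangentFibreEquiv : κ ⊗[R] (augIdeal (sectionAug f e he heW)).Cotangent ≃ₗ[κ] Cotangent A :=
  LinearEquiv.ofBijective _ (cotangentFibreMap_bijective f e he hW heW A p hP horig hU heU)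

/-- `cotangentFibreEquiv` is `cotangentFibreMap`. [cite: GortzWedhorn2023, Remark 17.15 (1)] -/
theorem cotangentFibreEquiv_apply (z : κ ⊗[R] (augIdeal (sectionAug f e he heW)).Cotangent) :
    cotangentFibreEquiv f e he hW heW A p hP horig hU heU z = cotangentFibreMap f e he hW heW A p hP horig hU heU z :=
  rfl

end Equiv

end AbelianVariety

end Literature.AlgebraicGeometry.Motives

end
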